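import Literature.AlgebraicGeometry.Resolution.PointBlowupObliqueNormalForm
import Literature.AlgebraicGeometry.Resolution.CentreBlowupResidueInequality
import HarnessLib

/-!
# Hauser–Perlega 2019, §3 Theorem (5): the `pᵉ`-th-power normal form of the sheared initial form,
  PROVED in the point-blow-up model (from (4)), and its equivalence with (4)

Source: H. Hauser, S. Perlega, *Characterizing the increase of the residual order under blowup in
positive characteristic*, Publ. RIMS **55** (2019) 835–857 [`HauserPerlega2019PRIMS`], §3 Theorem,
assertion (5) (arXiv:1906.09593, §3): "Denote by `t` the vector in `Kⁿ` of components `tᵢ` for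
`i ∈ T ∖ {1}`, and `0` otherwise. The polynomial `G(x)` of the factorization `F(x) = xʳ·G(x)` has, up
to `pᵉ`-th powers, a unique form,
`G((1,x₂,…,xₙ)+t) = ⌊∏_{i∈T∖{1}} (xᵢ+tᵢ)^{−rᵢ} · N^{pᵉ}(x₂,…,xₙ)⌋ᵤ` for some polynomial
`N(x₂,…,xₙ)`", stated in the text as a consequence of assertion (4) "`ord^{mod pᵉ}_{Q_T} F > u`"
("The inequality `ord^{mod pᵉ}_{Q_T} F > u` from (4) implies the following conditions (5) to (9)").
The same normal form is the "fundamental metastable equality" (33.18) of H. Hironaka's 2011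
manuscript *Resolution of singularities* (Tordesillas), Th. 33.3 p. 85 — an unrefereed earlier
version of the programme, cited here as CONTEXT only [`Hironaka2011Tordesillas`].

The tree already types (4) as `HauserPerlega2019.ObliqueOrderCondition q j t u P`
(`u < ord^{mod q}` of `shear_{j,t} P` in the variables other than `y_j`, `PointBlowupShadeCentres.lean`)
and PROVES it at every increase of the shade in the point-blow-up model
(`PointBlowup.condition4_of_shadeIncreases`, `CentreBlowupResidueInequality.lean`), and types (5) as
the PREDICATE `HauserPerlega2019.NormalFormCongruence q j t u F` (`PointBlowupObliqueNormalForm.lean`: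
"the `u`-jet of `F((1,x)+t)` is a `pᵉ`-th power `N^{pᵉ}`", in the sheared homogeneous coordinates;
"A PREDICATE ('(4) implies (5)' is the printed theorem, not asserted)").  This file proves:

* `HauserPerlega2019.isPthPowerExponent_of_obliqueOrderCondition` — under (4), every monomial of
  `shear_{j,t} P` of degree `≤ u` in the variables other than `y_j` is a `q`-th power monomial
  (all exponents divisible by `q`);
* `HauserPerlega2019.normalFormCongruence_of_obliqueOrderCondition` — **(4) ⇒ (5)** for `q = pᵏ`
  over a perfect ring of characteristic `p` (the `q`-th roots of the coefficients give `N`); no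
  homogeneity hypothesis is needed for the predicate as typed;
* `HauserPerlega2019.obliqueOrderCondition_of_normalFormCongruence` — the converse **(5) ⇒ (4)**
  for `P` homogeneous of degree `o` with `q ∣ o` (any commutative ring of characteristic `p`), so that
  at an increase of the shade — where `q ∣ o = ord₀ F` holds by Hauser's condition (1) — the two
  printed assertions are EQUIVALENT in the model
  (`HauserPerlega2019.normalFormCongruence_iff_obliqueOrderCondition`);
* `PointBlowup.normalFormCongruence_of_shadeIncreases` — **assertion (5) at every increase of the
  shade** under a point blow-up of `x^{pᵉ} + F(y)` (every dimension, every `e ≥ 0` with `pᵉ ≤ ord₀ F`,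
  `yʳ ∣ F`; perfect ground field), with `u = HauserPerlega2019.residualDegree j b s` and the initial
  form `HauserPerlega2019.initialForm s.F`, by composing with `PointBlowup.condition4_of_shadeIncreases`.

Scope (honest): this is the MODEL statement (fixed coordinates, point blow-ups, polynomial residual
`F`, the divisor's multiplicities in `u` — the atlas' reading recorded in `residualDegree`; the printed
`rᵢ = ord_{(xᵢ)} In F` give a smaller `u`, for which (4)/(5) are weaker and follow).  The UNIQUENESS clause
of (5) ("up to `pᵉ`-th powers, a unique form") and Hauser's §G (4) proper (the oblique polynomial) are
not addressed.  Nothing here is a statement about the manuscripts under adjudication in the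
`res-hironaka` cell; AI-assisted formalisation (cell `res-hironaka`, seat res-lit-5), kernel-checked.
-/

open MvPolynomial Finset
open scoped BigOperators

namespace Literature.AlgebraicGeometry.Resolution

open Literature.AlgebraicGeometry.Resolution.Hauser2010

namespace HauserPerlega2019

variable {σ : Type*} {K : Type*} [CommRing K]

/-- `|m − m_j e_j| + m_j = |m|`. [folklore] -/
private theorem degree_erase_add_apply (j : σ) (m : σ →₀ ℕ) : (m.erase j).degree + m j = m.degree := by
  conv_rhs => rw [← Finsupp.erase_add_single j m]
  rw [map_add, Finsupp.degree_single]

/-- The degree of `m` in the variables other than `y_j` is the degree of `m − m_j e_j`. [folklore] -/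
private theorem degree_sub_apply_eq_degree_erase (j : σ) (m : σ →₀ ℕ) :
    m.degree - m j = (m.erase j).degree := by
  have := degree_erase_add_apply j m
  omega

/-- **Under (4), the low monomials of the sheared polynomial are `q`-th powers.**  If
`u < ord^{mod q}_{≠ j}(shear_{j,t} P)` then every monomial `y^m` of `shear_{j,t} P` whose degree in the
variables other than `y_j` is `≤ u` has all its exponents divisible by `q` (otherwise it survives the
deletion of the `q`-th-power monomials and bounds the order by `≤ u`).
[cite: HauserPerlega2019PRIMS, §3 Theorem (4)] -/
theorem isPthPowerExponent_of_obliqueOrderCondition [DecidableEq σ] {q : ℕ} {j : σ} {t : σ → K} {u : ℕ}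
    {P : MvPolynomial σ K} (h : ObliqueOrderCondition q j t u P) {m : σ →₀ ℕ}
    (hm : coeff m (shear j t P) ≠ 0) (hdeg : m.degree - m j ≤ u) : IsPthPowerExponent q m := by
  by_contra hnot
  have hc : coeff m (deletePthPowers q (shear j t P)) ≠ 0 := by
    rw [coeff_deletePthPowers, if_neg hnot]
    exact hm
  have hle : pOrderAwayFrom q j (shear j t P) ≤ ((m.degree - m j : ℕ) : ℕ∞) := by
    unfold pOrderAwayFrom orderAwayFrom
    exact Finset.inf_le (MvPolynomial.mem_support_iff.mpr hc)
  unfold ObliqueOrderCondition at h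
  have hlt : (u : ℕ∞) < ((m.degree - m j : ℕ) : ℕ∞) := lt_of_lt_of_le h hle
  exact absurd (by exact_mod_cast hlt : u < m.degree - m j) (not_lt.mpr hdeg)

section CharP

variable (p : ℕ) [Fact p.Prime] [CharP K p]

/-- **Assertion (4) implies assertion (5)** ([HP19 PRIMS] §3: "The inequality `ord^{mod pᵉ}_{Q_T} F > u`
from (4) implies the following conditions (5) to (9)"), in the tree's sheared coordinates and for
`q = pᵏ` over a perfect ring of characteristic `p`: the coefficients of `shear_{j,t} P` at the monomials
`y^d · y_j^{deg P − |d|}` (`d_j = 0`, `|d| ≤ u`) are those of `N^q`, where `N` is the sum of the `q`-th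
roots of these monomials with `y_j` deleted (they are `q`-th power monomials by
`isPthPowerExponent_of_obliqueOrderCondition`).  No homogeneity hypothesis is used.
[cite: HauserPerlega2019PRIMS, §3 Theorem (5)] -/
theorem normalFormCongruence_of_obliqueOrderCondition [DecidableEq σ] [PerfectRing K p] (k : ℕ) {j : σ} {t : σ → K}
    {u : ℕ} {P : MvPolynomial σ K} (h : ObliqueOrderCondition (p ^ k) j t u P) :
    NormalFormCongruence (p ^ k) j t u P := by
  classical
  set Q : MvPolynomial σ K := shear j t P with hQ
  set o : ℕ := P.totalDegree with ho
  -- the monomials of `Q` that the predicate looks at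
  set S : Finset (σ →₀ ℕ) :=
    Q.support.filter fun m => (m.erase j).degree ≤ u ∧ m j = o - (m.erase j).degree with hS
  set root : K → K := ((frobeniusEquiv K p).symm : K → K)^[k] with hroot
  have hmemS : ∀ {m}, m ∈ S ↔ coeff m Q ≠ 0 ∧ (m.erase j).degree ≤ u ∧
      m j = o - (m.erase j).degree := by
    intro m
    rw [hS, Finset.mem_filter, MvPolynomial.mem_support_iff]
  -- every `m ∈ S` is a `q`-th power exponent
  have hpow : ∀ m ∈ S, IsPthPowerExponent (p ^ k) m := by
    intro m hm
    obtain ⟨hc, hu, -⟩ := hmemS.mp hm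
    exact isPthPowerExponent_of_obliqueOrderCondition h hc
      (by rw [degree_sub_apply_eq_degree_erase]; exact hu)
  -- a member of `S` is determined by its `j`-free part
  have hrecon : ∀ m ∈ S, m = m.erase j + Finsupp.single j (o - (m.erase j).degree) := by
    intro m hm
    obtain ⟨-, -, hmj⟩ := hmemS.mp hm
    conv_lhs => rw [← Finsupp.erase_add_single j m]
    rw [hmj]
  refine ⟨∑ m ∈ S, monomial (Finsupp.mapRange (· / p ^ k) (Nat.zero_div _) (m.erase j))
      (root (coeff m Q)), ?_, ?_⟩
  · -- `N` does not involve `y_j`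
    intro d hd
    rw [MvPolynomial.mem_support_iff, coeff_sum] at hd
    obtain ⟨m, -, hmd⟩ := Finset.exists_ne_zero_of_sum_ne_zero hd
    rw [coeff_monomial] at hmd
    by_cases he : Finsupp.mapRange (· / p ^ k) (Nat.zero_div _) (m.erase j) = d
    · rw [← he]
      simp
    · exact absurd (if_neg he) hmd
  · intro d hdj hdu
    -- `N^q = Σ_{m ∈ S} c_m · y^{m − m_j e_j}`
    have hNq : (∑ m ∈ S, monomial (Finsupp.mapRange (· / p ^ k) (Nat.zero_div _) (m.erase j))
        (root (coeff m Q))) ^ p ^ k = ∑ m ∈ S, monomial (m.erase j) (coeff m Q) := by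
      rw [sum_pow_char_pow p k]
      refine Finset.sum_congr rfl fun m hm => ?_
      rw [monomial_pow]
      have h1 : p ^ k • Finsupp.mapRange (· / p ^ k) (Nat.zero_div _) (m.erase j) = m.erase j := by
        ext i
        simp only [Finsupp.coe_smul, Pi.smul_apply, smul_eq_mul, Finsupp.mapRange_apply]
        by_cases hij : i = j
        · subst hij
          simp
        · rw [Finsupp.erase_ne hij]
          exact Nat.mul_div_cancel' ((isPthPowerExponent_iff _ _).mp (hpow m hm) i)
      have h2 : root (coeff m Q) ^ p ^ k = coeff m Q := by
        rw [hroot]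
        exact iterate_frobeniusEquiv_symm_pow_p_pow K p (coeff m Q) k
      rw [h1, h2]
    rw [hNq, coeff_sum]
    simp only [coeff_monomial]
    -- the only candidate is `m₀ = d + (o − |d|) e_j`
    set m₀ : σ →₀ ℕ := d + Finsupp.single j (o - d.degree) with hm₀
    have hdj' : d.erase j = d := by
      ext i
      by_cases hij : i = j
      · subst hij
        rw [Finsupp.erase_same, hdj]
      · rw [Finsupp.erase_ne hij]
    have herase : m₀.erase j = d := by
      rw [hm₀, Finsupp.erase_add, Finsupp.erase_single, add_zero, hdj']
    have hm₀j : m₀ j = o - d.degree := by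
      rw [hm₀, Finsupp.add_apply, hdj, Finsupp.single_eq_same, zero_add]
    -- any `m ∈ S` with `m − m_j e_j = d` is `m₀`
    have huniq : ∀ m ∈ S, m.erase j = d → m = m₀ := by
      intro m hm he
      rw [hrecon m hm, he, hm₀]
    by_cases hc : coeff m₀ Q = 0
    · rw [hc]
      refine (Finset.sum_eq_zero fun m hm => ?_).symm
      by_cases he : m.erase j = d
      · exfalso
        exact (hmemS.mp hm).1 (huniq m hm he ▸ hc)
      · rw [if_neg he]
    · have hm₀S : m₀ ∈ S := by
        refine hmemS.mpr ⟨hc, ?_, ?_⟩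
        · rw [herase]; exact hdu
        · rw [herase, hm₀j]
      rw [Finset.sum_eq_single_of_mem m₀ hm₀S fun m hm hne => ?_]
      · rw [if_pos herase]
      · rw [if_neg fun he => hne (huniq m hm he)]

omit [Fact p.Prime] [CharP K p] in
/-- The shear maps forms to forms of the same degree. [folklore] -/
private theorem isHomogeneous_shear [DecidableEq σ] (j : σ) (t : σ → K) {P : MvPolynomial σ K} {o : ℕ}
    (hP : P.IsHomogeneous o) : (shear j t P).IsHomogeneous o := by
  have h := hP.aeval (fun i => if i = j then (X j : MvPolynomial σ K) else X i + C (t i) * X j)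
    (n := 1) (fun i => by
      by_cases hij : i = j
      · rw [if_pos hij]; exact isHomogeneous_X K j
      · rw [if_neg hij]
        exact (isHomogeneous_X K i).add ((isHomogeneous_C σ (t i)).mul (isHomogeneous_X K j)))
  rw [one_mul] at h
  exact h

/-- **Assertion (5) implies assertion (4)** for a FORM `P` of degree `o` divisible by `q = pᵏ` (any
commutative ring of characteristic `p`): if the low coefficients of `shear_{j,t} P` are those of a
`q`-th power `N^q`, then every monomial of `shear_{j,t} P` of degree `≤ u` away from `y_j` has all
exponents divisible by `q` (the `y_j`-exponent `o − |d|` included, as `q ∣ o`), hence is deleted, and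
`ord^{mod q}_{≠ j} > u`.  [cite: HauserPerlega2019PRIMS, §3 Theorem (4)–(5)] -/
theorem obliqueOrderCondition_of_normalFormCongruence [DecidableEq σ] (k : ℕ) {j : σ} {t : σ → K} {u o : ℕ}
    {P : MvPolynomial σ K} (hP : P.IsHomogeneous o) (hqo : p ^ k ∣ o)
    (h5 : NormalFormCongruence (p ^ k) j t u P) : ObliqueOrderCondition (p ^ k) j t u P := by
  classical
  unfold ObliqueOrderCondition pOrderAwayFrom
  by_cases hP0 : P = 0
  · subst hP0
    have : shear j t (0 : MvPolynomial σ K) = 0 := by simp [shear]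
    rw [this, deletePthPowers_zero, orderAwayFrom_zero]
    exact ENat.coe_lt_top u
  have hdegP : P.totalDegree = o := hP.totalDegree hP0
  obtain ⟨N, -, hN⟩ := h5
  -- show: no surviving monomial of `z`-degree `≤ u`
  by_contra hle
  rw [not_lt] at hle
  obtain ⟨n, hn⟩ := ENat.ne_top_iff_exists.mp (ne_top_of_le_ne_top (ENat.coe_ne_top u) hle)
  obtain ⟨⟨m, hm, hmdeg⟩, -⟩ := (orderAwayFrom_eq_natCast_iff j _ n).mp hn.symm
  have hnu : n ≤ u := by
    rw [← hn] at hle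
    exact_mod_cast hle
  rw [coeff_deletePthPowers] at hm
  by_cases hpe : IsPthPowerExponent (p ^ k) m
  · exact hm (if_pos hpe)
  rw [if_neg hpe] at hm
  -- `shear P` is a form of degree `o`, so `|m| = o`
  have hmo : m.degree = o := by
    have h := isHomogeneous_shear j t hP (MvPolynomial.mem_support_iff.mp
      (MvPolynomial.mem_support_iff.mpr hm))
    simpa [Finsupp.weight, Finsupp.linearCombination, Finsupp.degree, Finsupp.sum] using h
  set d : σ →₀ ℕ := m.erase j with hd
  have hddeg : d.degree = n := by
    rw [hd, ← degree_sub_apply_eq_degree_erase]; exact hmdeg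
  have hmj : m j = o - d.degree := by
    have := degree_erase_add_apply j m
    rw [← hd, hmo] at this
    omega
  have hmd : m = d + Finsupp.single j (o - d.degree) := by
    conv_lhs => rw [← Finsupp.erase_add_single j m]
    rw [← hd, hmj]
  have hcoeff := hN d (by rw [hd]; exact Finsupp.erase_same) (by rw [hddeg]; exact hnu)
  rw [hdegP, ← hmd] at hcoeff
  -- all exponents of `m` are divisible by `q`
  apply hpe
  rw [isPthPowerExponent_iff]
  have hdi : ∀ i, i ≠ j → p ^ k ∣ d i := by
    intro i hij
    by_contra hndvd
    have hz := coeff_pow_char_pow_eq_zero p k N d i hndvd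
    exact hm (hcoeff.trans hz)
  have hdall : ∀ i, p ^ k ∣ d i := by
    intro i
    by_cases hij : i = j
    · subst hij
      rw [hd, Finsupp.erase_same]
      exact dvd_zero _
    · exact hdi i hij
  intro i
  by_cases hij : i = j
  · subst hij
    rw [hmj]
    have hdeg : p ^ k ∣ d.degree := by
      rw [Finsupp.degree_apply]
      exact Finset.dvd_sum fun i _ => hdall i
    exact Nat.dvd_sub hqo hdeg
  · have : m i = d i := by rw [hd, Finsupp.erase_ne hij]
    rw [this]
    exact hdi i hij

/-- **(4) ⟺ (5) for forms of degree divisible by `q`** — the situation at every increase of the shade,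
where `q ∣ ord₀ F` is Hauser's condition (1) (`PointBlowup.orderCondition_of_shadeIncreases`).
[cite: HauserPerlega2019PRIMS, §3 Theorem (4)–(5)] -/
theorem normalFormCongruence_iff_obliqueOrderCondition [DecidableEq σ] [PerfectRing K p] (k : ℕ) {j : σ}
    {t : σ → K} {u o : ℕ} {P : MvPolynomial σ K} (hP : P.IsHomogeneous o) (hqo : p ^ k ∣ o) :
    NormalFormCongruence (p ^ k) j t u P ↔ ObliqueOrderCondition (p ^ k) j t u P :=
  ⟨obliqueOrderCondition_of_normalFormCongruence p k hP hqo,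
    normalFormCongruence_of_obliqueOrderCondition p k⟩

end CharP

end HauserPerlega2019

namespace PointBlowup

variable {σ : Type*} {K : Type*} [Field K] [Fintype σ] [DecidableEq σ] [DecidableEq K]
variable (p : ℕ) [hp : Fact p.Prime] [CharP K p] [PerfectRing K p]

/-- **[HP19 PRIMS] assertion (5) at every increase of the shade, in the point-blow-up model.**  If the
shade of the state `s = (F, r)` of order `o ≥ q = pᵉ` with `yʳ ∣ F` increases at the point `b` of the
`y_j`-chart (`b_j = 0`), then the initial form of `F`, sheared by `b`, has its low coefficients
(degree `≤ u = o − Σ_{i∈T} rᵢ` away from `y_j`) equal to those of a `q`-th power `N^q` — the `u`-jet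
of `F((1,x)+t)` is a `pᵉ`-th power: "`G((1,x₂,…,xₙ)+t) = ⌊∏(xᵢ+tᵢ)^{−rᵢ}·N^{pᵉ}(x₂,…,xₙ)⌋ᵤ`".
Perfect ground field; every dimension, every `e`.  Composition of
`PointBlowup.condition4_of_shadeIncreases` with `normalFormCongruence_of_obliqueOrderCondition`.
[cite: HauserPerlega2019PRIMS, §3 Theorem (5)] -/
theorem normalFormCongruence_of_shadeIncreases {e : ℕ} (j : σ) (b : σ → K) (hbj : b j = 0)
    (s : State σ K) {o : ℕ} (ho : ordZero s.F = o) (hqo : p ^ e ≤ o)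
    (hr : ∀ d ∈ s.F.support, s.r ≤ d) (hinc : ShadeIncreases (p ^ e) j b s) :
    HauserPerlega2019.NormalFormCongruence (p ^ e) j b (HauserPerlega2019.residualDegree j b s)
      (HauserPerlega2019.initialForm s.F) :=
  HauserPerlega2019.normalFormCongruence_of_obliqueOrderCondition p e
    (condition4_of_shadeIncreases (p ^ e) j b hbj s ho hqo hr hinc)

end PointBlowup

end Literature.AlgebraicGeometry.Resolution
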